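/-
Copyright (c) 2026 the pub-hodgecm-mathlib formalisation cell (harness21).  Prover seat hodgecm-mathlib-K2Liu-p01 (g0): Track B «K2-LIT», #184♮ = hLiu418,
helper H6 for socket #13 `sig_K2LiuDoublingUnfold` (U5 «DOUBLING ZETA», LEAD F0P6-plan (g10) DEAL BY NAME K2/STATUS 2026-09-03T21:14:18Z, RULING 21:19:59Z).
-/
import Literature.NumberTheory.K2Lit.DoublingZetaIntegral
import Summits.HodgeConjecture.HodgeConjecture.Theorems.K2LiuSiegelCharacterTrivialOnRational
import Summits.HodgeConjecture.HodgeConjecture.Theorems.K2LiuDoublingUnfoldBridge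
import HarnessLib

/-!
# Crux `HLiu418`, Track B road `K2_Liu`, unit U5, helper H6 for socket #13 `sig_K2LiuDoublingUnfold`:
# the TWIST `x ↦ conj χ_s(ι(a_x, a_x))`, `a_x = ιA((out x)⁻¹)` — its value `χ(det(a ⊗ 1))`, class-function property, continuity on `[G]`

Cell `hodgecm-mathlib`, crux item hLiu418 = `stmt-HodgeConjecture-24832`, route of record `HCCMUnconditional`; squad K2 ∕ K2Liu, LEAD F0P6-plan
(g10), prover K2Liu-p01 (g0) (REPORT-FIRST plan for #13, item H6).  THEOREMS ONLY (no `def`, no instance, no notation, no named-fact hypothesis,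
no `sorry`, default heartbeats); imports ★ K2Lit `DoublingZetaIntegral` (carriers of #13), ★ #10a `K2LiuSiegelCharacterTrivialOnRational` (p854746:
`siegelDeltaCharacter_eq_one_of_mem_ratH`), ★ H5 `K2LiuDoublingUnfoldBridge` (p854938: `iotaA_mem_quotientSubgroup_iff`,
`exists_continuousMulEquiv_eq_iotaA`) + HarnessLib; lane `--supports stmt-HodgeConjecture-24832 --as helper` (count-neutral).

THE TWIST of socket #13 (Liu 2021 Lem. B.11's «`φ(g) μ(det g)`» at `a = 0`, in the tree's left-coset dictionary): on `[G] = G(𝔸) ⧸ G(L⁺)`,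
`T(x) = conj χ_s(ι(a_x, a_x))`, `a_x = ιA((out x)⁻¹)`, `χ_s = siegelDeltaCharacter χ s` — typed through `Quotient.out`.  WHAT IS PROVED (under the
#13 binders `hg`, `ιA`, `hιA`, `hdV0`, `hdW0`):
* `siegelDeltaCharacter_iotaV_diag` — **`χ_s(ι(a, a)) = χ(det(a ⊗ 1))`** (★ `iotaV_diag`, ★ `chiDet_diagG`, ★ `modDelta_diagG = 1`: `|det_Δ ι(a,a)| = 1`);
* `continuous_twistFun` — `g ↦ χ_s(ι(ιA g⁻¹, ιA g⁻¹))` is continuous on `G(𝔸)` (`χ ∘ det ∘ (· ⊗ 1) ∘ ιA ∘ inv`; `ιA` continuous as the ★ similitude iso, H5);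
* `twistFun_mul_mem` — **class function**: `χ_s(ι(ιA (gγ)⁻¹, ιA (gγ)⁻¹)) = χ_s(ι(ιA g⁻¹, ιA g⁻¹))` for `γ ∈ G(L⁺)` (multiplicativity of `χ_s` on `P_Δ(𝔸)`, ★
  `siegelDeltaCharacter_mul` + ★ `isSiegelDelta_iotaV_diag`; `ι(ιA γ⁻¹, ιA γ⁻¹)` is RATIONAL — H5 `iotaA_mem_quotientSubgroup_iff`, ★
  `adelicInl_toAdelic_mem_range`, ★ `diagG_rational` — so `χ_s` of it is `1` by ★ #10a);
* `twist_out_mk` — the `Quotient.out`-typed twist at `x = gΓ` equals the value at `g`; **`continuous_twist`** — `T` is continuous on `[G]`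
  (`QuotientGroup.isQuotientMap_mk`) — so `φ₂^χ := T · φ₂` is a legitimate `F₂` for the engine ★ `K2LiuDoublingUnfoldEngine` (H3).

HONEST LABEL.  Count-neutral helper; `HC_CM` is proved only modulo the 7 printed citations (hLiu418 = 24832, h413 = 24833) until rung 0 closes.

## References
* [Liu2021] Y. Liu, *Fourier–Jacobi cycles and arithmetic relative trace formula*, Camb. J. Math. 9 (2021): App. B §B.3 (B.7) p. 101, Lem. B.11 p. 102.
* [HarrisKudlaSweet1996] M. Harris, S. S. Kudla, W. J. Sweet, *Theta dichotomy for unitary groups*, J. AMS 9 (1996): §1 (1.11)–(1.15) (`χ(det)` on the diagonal).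
-/

noncomputable section

open scoped Matrix
open NumberField IsDedekindDomain

namespace Summit.HodgeConjecture.HodgeConjecture.Cruxes.HLiu418.K2LiuDoublingUnfoldTwist

open Literature.NumberTheory.Automorphic Literature.NumberTheory.GaloisRepresentations
open Literature.NumberTheory.Automorphic.UnitaryGroup (adelicGroupData adelicVal)
open Literature.NumberTheory.GelbartRogawski1991 Literature.NumberTheory.GelbartRogawski1991.GRConstruction
open Literature.NumberTheory.K2Lit.SiegelDoubled
open Summit.HodgeConjecture.HodgeConjecture.Cruxes.HLiu418.K2LiuDoublingUnfoldBridge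

variable (L : Type) [Field L] [NumberField L] [IsCMField L]
variable {N M n : ℕ} (e : Fin N × Fin M ≃ Fin n) (H : Matrix (Fin N) (Fin N) L)
  (dV : Fin N → L) (hdV : ∀ i, IsCMField.complexConj L (dV i) = dV i) (hdV0 : ∀ i, dV i ≠ 0)
  (dW : Fin M → L) (hdW : ∀ i, IsCMField.complexConj L (dW i) = dW i) (hdW0 : ∀ i, dW i ≠ 0)
  (t : L) (ht : t ≠ 0) (g : GL (Fin N) L)
  (hg : formCongr ((IsCMField.complexConj L : L ≃ₐ[↥(maximalRealSubfield L)] L) : L →+* L) g (t • H) = Matrix.diagonal dV)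
  (ιA : (adelicGroupData (↥(maximalRealSubfield L)) L (IsCMField.complexConj L) N H).Adelic →*
    ↥(UnitaryGroup.adelic (↥(maximalRealSubfield L)) L (IsCMField.complexConj L) N (Matrix.diagonal dV)))
  (hιA : ∀ k, ((ιA k : ↥(UnitaryGroup.adelic (↥(maximalRealSubfield L)) L (IsCMField.complexConj L) N (Matrix.diagonal dV))) :
        GL (Fin N) (AdeleRing (𝓞 L) L)) =
      (toAdeleGL L g)⁻¹ * adelicVal (↥(maximalRealSubfield L)) L (IsCMField.complexConj L) N H k * toAdeleGL L g)
  (χ : HeckeCharacter L) (s : ℂ)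

/-! ## §1 The value of `χ_s` on the diagonal `ι(a, a)` -/

include hdV0 hdW0 in
/-- **`χ_s(ι(a, a)) = χ(det(a ⊗ 1))`** for `a ∈ U(V)(𝔸)`: `ι(a,a) = (a ⊗ 1, a ⊗ 1)` (★ `iotaV_diag`), `χ(det_Δ ·) = χ(det(a ⊗ 1))` (★ `chiDet_diagG`) and
`|det_Δ ι(a,a)|^{1/2} = 1` (★ `modDelta_diagG`, relative norm one), so the modulus factor is `1^{2s+n} = 1`. [cite: HarrisKudlaSweet1996, §1 (1.11)–(1.15)] -/
theorem siegelDeltaCharacter_iotaV_diag (a : UnitaryGroup.adelic (Fp L) L (IsCMField.complexConj L) N (Matrix.diagonal dV)) :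
    siegelDeltaCharacter L e dV hdV dW hdW χ s (iotaV L e dV hdV dW hdW (a, a)) =
      ((χ (Matrix.GeneralLinearGroup.det
        ((UnitaryGroup.adelicInl (Fp L) L (IsCMField.complexConj L) N M (Matrix.diagonal dV) (Matrix.diagonal dW) a :
            UnitaryGroup.adelicPair (Fp L) L (IsCMField.complexConj L) N M (Matrix.diagonal dV) (Matrix.diagonal dW)) :
          GL (Fin N × Fin M) (AdeleRing (𝓞 L) L))) : ℂˣ) : ℂ) := by
  unfold siegelDeltaCharacter
  rw [iotaV_diag, chiDet_diagG, modDelta_diagG L e dV hdV hdV0 dW hdW hdW0]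
  simp

/-! ## §2 Continuity of `g ↦ χ_s(ι(ιA g⁻¹, ιA g⁻¹))` on `G(𝔸)` -/

include hdV0 hdW0 ht hg hιA in
/-- **`g ↦ χ_s(ι(ιA g⁻¹, ιA g⁻¹))` is continuous on `G(𝔸)`** — it is `χ ∘ det ∘ (· ⊗ 1) ∘ ιA ∘ (·)⁻¹` (§1), `χ` and `det` are continuous, `· ⊗ 1` is ★
`continuous_adelicInl`, and `ιA` is continuous (it IS the ★ similitude isomorphism, H5 `exists_continuousMulEquiv_eq_iotaA`).
[cite: Liu2021, Lem. B.11 p. 102] -/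
theorem continuous_twistFun :
    Continuous fun k : (adelicGroupData (↥(maximalRealSubfield L)) L (IsCMField.complexConj L) N H).Adelic =>
      siegelDeltaCharacter L e dV hdV dW hdW χ s (iotaV L e dV hdV dW hdW (ιA k⁻¹, ιA k⁻¹)) := by
  obtain ⟨Φ, -, hΦ⟩ := exists_continuousMulEquiv_eq_iotaA L H dV t ht g hg ιA hιA
  have hιc : Continuous ιA := by
    have h : (ιA : _ → _) = Φ := funext fun x => (hΦ x).symm
    rw [h]
    exact Φ.continuous
  simp_rw [siegelDeltaCharacter_iotaV_diag L e dV hdV hdV0 dW hdW hdW0 χ s]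
  refine Units.continuous_val.comp ?_
  have hχ : Continuous (χ : ideleGroup L → ℂˣ) := by
    rw [← HeckeCharacter.coe_toContinuousMonoidHom]
    exact χ.toContinuousMonoidHom.continuous
  exact hχ.comp (Matrix.GeneralLinearGroup.continuous_det.comp (continuous_subtype_val.comp
    ((UnitaryGroup.continuous_adelicInl (Fp L) L (IsCMField.complexConj L) N M (Matrix.diagonal dV) (Matrix.diagonal dW)).comp
      (hιc.comp continuous_inv))))

/-! ## §3 Class-function property -/

include ht hg hιA in
/-- `ι(ιA γ, ιA γ) ∈ H(L⁺)` for `γ ∈ G(L⁺)` (`ιA γ` is rational by H5 `iotaA_mem_quotientSubgroup_iff`; `a ↦ a ⊗ 1` and `x ↦ (x, x)` preserve rationality, ★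
`adelicInl_toAdelic_mem_range`, ★ `diagG_rational`). [cite: Liu2021, Lem. B.11 p. 102] -/
theorem iotaV_diag_iotaA_mem_ratH {γ : (adelicGroupData (↥(maximalRealSubfield L)) L (IsCMField.complexConj L) N H).Adelic}
    (hγ : γ ∈ (adelicGroupData (↥(maximalRealSubfield L)) L (IsCMField.complexConj L) N H).quotientSubgroup) :
    iotaV L e dV hdV dW hdW (ιA γ, ιA γ) ∈ ratH L e dV hdV dW hdW := by
  have hrat := (iotaA_mem_quotientSubgroup_iff L H dV t ht g hg ιA hιA γ).2 hγ
  rw [AdelicGroupData.quotientSubgroup, show (adelicGroupData (↥(maximalRealSubfield L)) L (IsCMField.complexConj L) N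
      (Matrix.diagonal dV)).center' = ⊥ from rfl, bot_sup_eq, AdelicGroupData.arithmeticSubgroup] at hrat
  obtain ⟨γ₀, hγ₀⟩ := MonoidHom.mem_range.mp hrat
  rw [iotaV_diag]
  refine diagG_rational L e dV hdV dW hdW _ ?_
  have h : ιA γ = UnitaryGroup.toAdelic (Fp L) L (IsCMField.complexConj L) N (Matrix.diagonal dV) γ₀ := hγ₀.symm
  rw [h]
  exact UnitaryGroup.adelicInl_toAdelic_mem_range (Fp L) L (IsCMField.complexConj L) N M (Matrix.diagonal dV) (Matrix.diagonal dW) γ₀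

include ht hg hιA in
/-- **Class function**: for `γ ∈ G(L⁺)`, `χ_s(ι(ιA (kγ)⁻¹, ιA (kγ)⁻¹)) = χ_s(ι(ιA k⁻¹, ιA k⁻¹))` — `(kγ)⁻¹ = γ⁻¹ k⁻¹`, `χ_s` is multiplicative on
`P_Δ(𝔸) ∋ ι(a, a)` (★ `siegelDeltaCharacter_mul`, ★ `isSiegelDelta_iotaV_diag`), and `χ_s(ι(ιA γ⁻¹, ιA γ⁻¹)) = 1` because that element is RATIONAL
(`iotaV_diag_iotaA_mem_ratH`; ★ #10a `siegelDeltaCharacter_eq_one_of_mem_ratH`: `χ|_{L^×} = 1` and the product formula).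
[cite: Liu2021, §B.3 (B.7) p. 101] [cite: Liu2021, Lem. B.11 p. 102] -/
theorem twistFun_mul_mem (k : (adelicGroupData (↥(maximalRealSubfield L)) L (IsCMField.complexConj L) N H).Adelic)
    {γ : (adelicGroupData (↥(maximalRealSubfield L)) L (IsCMField.complexConj L) N H).Adelic}
    (hγ : γ ∈ (adelicGroupData (↥(maximalRealSubfield L)) L (IsCMField.complexConj L) N H).quotientSubgroup) :
    siegelDeltaCharacter L e dV hdV dW hdW χ s (iotaV L e dV hdV dW hdW (ιA (k * γ)⁻¹, ιA (k * γ)⁻¹)) =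
      siegelDeltaCharacter L e dV hdV dW hdW χ s (iotaV L e dV hdV dW hdW (ιA k⁻¹, ιA k⁻¹)) := by
  have hsplit : iotaV L e dV hdV dW hdW (ιA (k * γ)⁻¹, ιA (k * γ)⁻¹) =
      iotaV L e dV hdV dW hdW (ιA γ⁻¹, ιA γ⁻¹) * iotaV L e dV hdV dW hdW (ιA k⁻¹, ιA k⁻¹) := by
    rw [mul_inv_rev, map_mul ιA, ← map_mul (iotaV L e dV hdV dW hdW), Prod.mk_mul_mk]
  rw [hsplit, siegelDeltaCharacter_mul L e dV hdV dW hdW χ s (isSiegelDelta_iotaV_diag L e dV hdV dW hdW _)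
    (isSiegelDelta_iotaV_diag L e dV hdV dW hdW _),
    K2LiuSiegelCharacterTrivialOnRational.siegelDeltaCharacter_eq_one_of_mem_ratH χ s
      (iotaV_diag_iotaA_mem_ratH L e H dV hdV dW hdW t ht g hg ιA hιA (inv_mem hγ)), one_mul]

/-! ## §4 The `Quotient.out`-typed twist: representative independence and continuity on `[G]` -/

include ht hg hιA in
/-- **The twist read at `Quotient.out (kΓ)` equals its value at `k`** (`out(kΓ) = k δ`, `δ ∈ G(L⁺)`, Mathlib `QuotientGroup.mk_out_eq_mul`, and §3).
[cite: Liu2021, Lem. B.11 p. 102] -/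
theorem twist_out_mk (k : (adelicGroupData (↥(maximalRealSubfield L)) L (IsCMField.complexConj L) N H).Adelic) :
    siegelDeltaCharacter L e dV hdV dW hdW χ s (iotaV L e dV hdV dW hdW
        (ιA ((Quotient.out (QuotientGroup.mk k :
              (adelicGroupData (↥(maximalRealSubfield L)) L (IsCMField.complexConj L) N H).Adelic ⧸
                (adelicGroupData (↥(maximalRealSubfield L)) L (IsCMField.complexConj L) N H).quotientSubgroup)) :
              (adelicGroupData (↥(maximalRealSubfield L)) L (IsCMField.complexConj L) N H).Adelic)⁻¹,
         ιA ((Quotient.out (QuotientGroup.mk k :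
              (adelicGroupData (↥(maximalRealSubfield L)) L (IsCMField.complexConj L) N H).Adelic ⧸
                (adelicGroupData (↥(maximalRealSubfield L)) L (IsCMField.complexConj L) N H).quotientSubgroup)) :
              (adelicGroupData (↥(maximalRealSubfield L)) L (IsCMField.complexConj L) N H).Adelic)⁻¹)) =
      siegelDeltaCharacter L e dV hdV dW hdW χ s (iotaV L e dV hdV dW hdW (ιA k⁻¹, ιA k⁻¹)) := by
  obtain ⟨δ, hδ⟩ := QuotientGroup.mk_out_eq_mul
    (adelicGroupData (↥(maximalRealSubfield L)) L (IsCMField.complexConj L) N H).quotientSubgroup k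
  rw [hδ]
  exact twistFun_mul_mem L e H dV hdV dW hdW t ht g hg ιA hιA χ s k δ.2

include hdV0 hdW0 ht hg hιA in
/-- **The twist `T(x) = conj χ_s(ι(ιA (out x)⁻¹, ιA (out x)⁻¹))` is continuous on `[G]`**: `T ∘ π = conj ∘ (k ↦ χ_s(ι(ιA k⁻¹, ιA k⁻¹)))` (§4a) is
continuous (§2), and `π : G(𝔸) → [G]` is a quotient map (Mathlib `QuotientGroup.isQuotientMap_mk`).  This makes `φ₂^χ = T · φ₂` an admissible `F₂` for
the unfolding engine ★ `K2LiuDoublingUnfoldEngine.unfold_orbitSum_prod_integral`. [cite: Liu2021, Lem. B.11 p. 102] -/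
theorem continuous_twist :
    Continuous fun x : (adelicGroupData (↥(maximalRealSubfield L)) L (IsCMField.complexConj L) N H).automorphicQuotient =>
      starRingEnd ℂ (siegelDeltaCharacter L e dV hdV dW hdW χ s (iotaV L e dV hdV dW hdW
        (ιA ((Quotient.out (x : (adelicGroupData (↥(maximalRealSubfield L)) L (IsCMField.complexConj L) N H).Adelic ⧸
              (adelicGroupData (↥(maximalRealSubfield L)) L (IsCMField.complexConj L) N H).quotientSubgroup)) :
              (adelicGroupData (↥(maximalRealSubfield L)) L (IsCMField.complexConj L) N H).Adelic)⁻¹,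
         ιA ((Quotient.out (x : (adelicGroupData (↥(maximalRealSubfield L)) L (IsCMField.complexConj L) N H).Adelic ⧸
              (adelicGroupData (↥(maximalRealSubfield L)) L (IsCMField.complexConj L) N H).quotientSubgroup)) :
              (adelicGroupData (↥(maximalRealSubfield L)) L (IsCMField.complexConj L) N H).Adelic)⁻¹))) := by
  refine (QuotientGroup.isQuotientMap_mk
    (adelicGroupData (↥(maximalRealSubfield L)) L (IsCMField.complexConj L) N H).quotientSubgroup).continuous_iff.2 ?_
  refine (Complex.continuous_conj.comp (continuous_twistFun L e H dV hdV hdV0 dW hdW hdW0 t ht g hg ιA hιA χ s)).congr fun k => ?_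
  simp only [Function.comp_apply]
  rw [twist_out_mk L e H dV hdV dW hdW t ht g hg ιA hιA χ s k]

end Summit.HodgeConjecture.HodgeConjecture.Cruxes.HLiu418.K2LiuDoublingUnfoldTwist
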